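import Mathlib
import Summits.NavierStokesRegularity.NavierStokesRegularity.Theses.MarginalTypeI
import Literature.Analysis.FluidPDE.AlbrittonBarkerForwardHolds
import HarnessLib

/-!
# `MarginalTypeI.ABForwardMeasurable` — Albritton–Barker forward with measurable slices
  (route `MarginalTypeI`, item stmt-NavierStokesRegularity-11302, support, fact-level)

**Statement.** A local Type-I singular point of a suitable weak solution yields a nontrivial mild
bounded ancient solution (`ν = 1`) with measurable slices, suitable on `ℝ³ × (−∞, 0)` with a weak
gradient and `𝐈 < ∞` (Albritton–Barker 2019, Thm. 1.1, forward direction; Seregin–Šverák 2009,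
Thm. 2.8).

PROOF. Verbatim the tree's `LocalTypeIBlowup.exists_ancientMild_of_localTypeISingularPoint`
(Seregin–Šverák's blow-up procedure, files `LocalTypeIBlowup/*`), whose conclusion carries the
measurable-slices clause.

HONEST FRAMING: a KNOWN theorem about HYPOTHETICAL Type-I singularities; nothing here bears on the
regularity problem beyond Albritton–Barker 2019.
-/

noncomputable section

set_option linter.dupNamespace false

namespace Summit.NavierStokesRegularity.NavierStokesRegularity.Theorems

/-- **Item stmt-NavierStokesRegularity-11302** (`MarginalTypeI.ABForwardMeasurable`). [AlbrittonBarker2019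
Thm 1.1 (forward); tree: `LocalTypeIBlowup.exists_ancientMild_of_localTypeISingularPoint`] -/
theorem marginalTypeI_abForwardMeasurable_proof :
    Summit.NavierStokesRegularity.NavierStokesRegularity.Theses.MarginalTypeI.ABForwardMeasurable := by
  unfold Summit.NavierStokesRegularity.NavierStokesRegularity.Theses.MarginalTypeI.ABForwardMeasurable
  rintro ⟨r₀, z, u, p, hloc⟩
  exact Literature.Analysis.FluidPDE.LocalTypeIBlowup.exists_ancientMild_of_localTypeISingularPoint hloc

end Summit.NavierStokesRegularity.NavierStokesRegularity.Theorems

end
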